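import Summits.Ventures.WeilGRH.TwistedWindowMeasure
import Summits.Ventures.WeilGRH.TwistedFlatTest
import Summits.Ventures.WeilGRH.TwistedFlatTestBounds
import Mathlib.Analysis.SpecialFunctions.Integrals.Basic
import HarnessLib

/-!
# GRH arm (rh-explicit, venture WeilGRH): THE FLAT-WINDOW IDENTITY — the rung inequality is sharp to
  `O(1/a)`, its slack is a Fejér integral of the spectral measure, and the spectral atom at the centre is
  the slope

Cell `rh-explicit`, WEIL TRACK (structure seat weil-3, gen9) for the GRH ARM.  Sequel of
`TwistedFlatTest.lean` (the flat-window INEQUALITY `2S_χ(a) + K_κ − I_κ(a)/a ≤ log q` from a `χ`-rung at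
`a`, `S_χ(a) = Σ_{log n<2a} Λ(n)n^{-1/2}(1 − log n/(2a)) Re χ(n)`) and of `TwistedWindowMeasure.lean`
(a `χ`-window measure represents the twisted window form on window functions).

Let `χ` be a Dirichlet character mod `q ≠ 1`, `a > 0`, and `μ` ANY positive measure representing `Q_χ` on
the tests of `[-a, a]` (such `μ` exist iff the rung holds) with `(1 + t²)⁻¹ ∈ L¹(μ)`.  Then:

* `weilMellin_chi_zero`, `norm_sq_weilMellin_chi_zero`: the flat window's transform on the critical line
  is the `sinc`, `‖χ̂_0(½+it)‖² = 2 sin²(at)/(at²)` (`= 2a` at `t = 0`): the Fejér kernel of the window;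
* **`flatWindow_eq_log_sub_integral` (THE IDENTITY)**:
  `2S_χ(a) + K_κ − I_κ(a)/a = log q − ∫ 2sin²(at)/(at²) dμ(t)` — the rung inequality with its slack made
  explicit (a non-negative Fejér integral of the spectral measure);
* **`flatWindow_sandwich`**: with `m₀ = μ{0}` and `M₂ = ∫ t⁻² dμ` (finite by hypothesis),
  `log q − K_κ + I_κ(a)/a − 2a·m₀ − (2/a)M₂ ≤ 2S_χ(a) ≤ log q − K_κ + I_κ(a)/a − 2a·m₀`;
  `flatWindow_add_atom_le_log`: the rung inequality SHARPENED by the atom, `2S_χ(a) + K_κ − I_κ(a)/a + 2a·μ{0} ≤ log q`;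
* **`abs_flatSum_add_atom_sub_le`**: `|2S_χ(a) + 2a·m₀ − (log q − K_κ)| ≤ (5 + 2M₂)/a`;
* all windows (`μ` represents `Q_χ` on every test — under `GRH(χ)` the zero heights of `L(s, χ)`):
  **`tendsto_flatSum_add_atom`** `2S_χ(a) + 2a·m₀ → log q − K_κ`, **`tendsto_flatSum_div`**
  `S_χ(a)/a → −m₀` (THE ATOM IS THE SLOPE), `tendsto_flatSum_of_measure_zero` (no atom ⟹
  `2S_χ(a) → log q − K_κ`, which is `−2Re(L′/L)(½, χ)` for primitive `χ` with `L(½, χ) ≠ 0`,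
  `FlatTestCentralL.neg_two_mul_re_logDeriv_LFunction_one_half`).

So the flat member of a `χ`-rung is ASYMPTOTICALLY EXTREMAL (the one-window inequalities, and with them
the family / progression / Chebotarev bounds of `CharacterFamily*.lean`, are sharp truncations of an
identity with error `O(1/a)` and linear term the spectral mass AT the centre); the `GRH(χ)` specialisation
(atom = `ord_{s=½} L(s, χ)`) is `FlatWindowSpectralGRH.lean`.  No definitions, no named facts, RH/GRH-free.

## References

* A. Weil, *Sur les "formules explicites" de la théorie des nombres premiers* (1952), (11) pp. 261–262.
  [Weil1952FormulesExplicites]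
* A. M. Odlyzko, *Bounds for discriminants and related estimates for class numbers, regulators and zeros
  of zeta functions: a survey of recent results*, Sém. Th. Nombres Bordeaux 2 (1990) 119–141, (2.3)–(2.6)
  (the explicit-formula method with the triangle kernel `F = 𝟙 ⋆ 𝟙̃`). [Odlyzko1990Bordeaux]
-/

set_option autoImplicit false

noncomputable section

open Complex Filter Set MeasureTheory
open scoped Real Topology ComplexConjugate ArithmeticFunction.vonMangoldt

namespace Summit.Ventures.WeilGRH

open Literature.NumberTheory.LFunctions
open Literature.NumberTheory.LFunctions.Yoshida1992 (chi chiCore)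
open Summit.RiemannHypothesis.RiemannHypothesis.Theorems.WeilFormatC

variable {q : ℕ} {a : ℝ}

/-! ## The transform of the flat window on the critical line: a `sinc` -/

/-- The flat window's transform as an interval integral: `χ̂_0(½+it) = (2a)^{-1/2} ∫_{-a}^{a} e^{itx} dx`. -/
theorem weilMellin_chi_zero_eq_intervalIntegral (ha : 0 < a) (t : ℝ) :
    weilMellin (chi a 0) (1 / 2 + t * I) =
      ((1 / Real.sqrt (2 * a) : ℝ) : ℂ) * ∫ x in (-a)..a, cexp ((t : ℂ) * I * (x : ℂ)) := by
  unfold weilMellin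
  rw [chi_zero_eq_ofReal_indicator a]
  have e : (fun x : ℝ ↦ (((Icc (-a) a).indicator (fun _ ↦ 1 / Real.sqrt (2 * a)) x : ℝ) : ℂ) *
      cexp ((1 / 2 + (t : ℂ) * I - 1 / 2) * (x : ℂ))) =
      (Icc (-a) a).indicator (fun x : ℝ ↦ ((1 / Real.sqrt (2 * a) : ℝ) : ℂ) * cexp ((t : ℂ) * I * (x : ℂ))) := by
    funext x
    by_cases hx : x ∈ Icc (-a) a
    · rw [indicator_of_mem hx, indicator_of_mem hx]
      congr 1
      ring_nf
    · rw [indicator_of_notMem hx, indicator_of_notMem hx, Complex.ofReal_zero, zero_mul]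
  rw [e, integral_indicator measurableSet_Icc, integral_Icc_eq_integral_Ioc,
    ← intervalIntegral.integral_of_le (by linarith), intervalIntegral.integral_const_mul]

/-- **The flat window's transform is a `sinc`**: `χ̂_0(½+it) = 2 sin(at) / (t √(2a))` for `t ≠ 0`. -/
theorem weilMellin_chi_zero (ha : 0 < a) {t : ℝ} (ht : t ≠ 0) :
    weilMellin (chi a 0) (1 / 2 + t * I) = ((2 * Real.sin (a * t) / (t * Real.sqrt (2 * a)) : ℝ) : ℂ) := by
  rw [weilMellin_chi_zero_eq_intervalIntegral ha]
  have hc : (t : ℂ) * I ≠ 0 := mul_ne_zero (by exact_mod_cast ht) Complex.I_ne_zero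
  rw [integral_exp_mul_complex hc]
  have hsin : cexp ((t : ℂ) * I * (a : ℂ)) - cexp ((t : ℂ) * I * ((-a : ℝ) : ℂ)) =
      2 * I * Complex.sin ((a : ℂ) * t) := by
    rw [Complex.sin]
    have e1 : (t : ℂ) * I * (a : ℂ) = (a : ℂ) * t * I := by ring
    have e2 : (t : ℂ) * I * ((-a : ℝ) : ℂ) = -((a : ℂ) * t) * I := by push_cast; ring
    rw [e1, e2]
    ring_nf
    rw [Complex.I_sq]
    ring
  rw [hsin, ← Complex.ofReal_mul, ← Complex.ofReal_sin]
  have hsq : (Real.sqrt (2 * a) : ℂ) ≠ 0 := by exact_mod_cast (Real.sqrt_pos.2 (by linarith)).ne'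
  have ht' : (t : ℂ) ≠ 0 := by exact_mod_cast ht
  push_cast
  field_simp

/-- At the centre: `χ̂_0(½) = √(2a)`. -/
theorem weilMellin_chi_zero_zero (ha : 0 < a) : weilMellin (chi a 0) (1 / 2 + (0 : ℝ) * I) = Real.sqrt (2 * a) := by
  rw [weilMellin_chi_zero_eq_intervalIntegral ha]
  simp only [Complex.ofReal_zero, zero_mul, Complex.exp_zero]
  rw [intervalIntegral.integral_const, Complex.real_smul, mul_one]
  have h2a : (0 : ℝ) < 2 * a := by linarith
  have hs : Real.sqrt (2 * a) ≠ 0 := (Real.sqrt_pos.2 h2a).ne'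
  have key : 1 / Real.sqrt (2 * a) * (a - -a) = Real.sqrt (2 * a) := by
    rw [show a - -a = 2 * a by ring]
    nth_rw 2 [← Real.mul_self_sqrt h2a.le]
    field_simp
  rw [← Complex.ofReal_mul, key]

/-- **`‖χ̂_0(½+it)‖² = 2 sin²(at)/(a t²)`** for `t ≠ 0` (the Fejér kernel of the window). -/
theorem norm_sq_weilMellin_chi_zero (ha : 0 < a) {t : ℝ} (ht : t ≠ 0) :
    ‖weilMellin (chi a 0) (1 / 2 + t * I)‖ ^ 2 = 2 * Real.sin (a * t) ^ 2 / (a * t ^ 2) := by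
  rw [weilMellin_chi_zero ha ht, Complex.norm_real, Real.norm_eq_abs, sq_abs, div_pow, mul_pow, mul_pow,
    Real.sq_sqrt (by linarith)]
  field_simp

/-- **`‖χ̂_0(½)‖² = 2a`**. -/
theorem norm_sq_weilMellin_chi_zero_zero (ha : 0 < a) :
    ‖weilMellin (chi a 0) (1 / 2 + (0 : ℝ) * I)‖ ^ 2 = 2 * a := by
  rw [weilMellin_chi_zero_zero ha, Complex.norm_real, Real.norm_eq_abs, sq_abs, Real.sq_sqrt (by linarith)]

/-- `‖χ̂_0(½+it)‖² ≤ 2a` for every `t` (`|sin y| ≤ |y|`). -/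
theorem norm_sq_weilMellin_chi_zero_le (ha : 0 < a) (t : ℝ) :
    ‖weilMellin (chi a 0) (1 / 2 + t * I)‖ ^ 2 ≤ 2 * a := by
  rcases eq_or_ne t 0 with rfl | ht
  · exact (norm_sq_weilMellin_chi_zero_zero ha).le
  · rw [norm_sq_weilMellin_chi_zero ha ht, div_le_iff₀ (by positivity)]
    have h := Real.abs_sin_le_abs (x := a * t)
    have h2 : Real.sin (a * t) ^ 2 ≤ (a * t) ^ 2 := by
      rw [← sq_abs (Real.sin _), ← sq_abs (a * t)]
      exact pow_le_pow_left₀ (abs_nonneg _) h 2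
    nlinarith

/-- `‖χ̂_0(½+it)‖² ≤ 2/(a t²)` for `t ≠ 0` (`sin² ≤ 1`). -/
theorem norm_sq_weilMellin_chi_zero_le_div (ha : 0 < a) {t : ℝ} (ht : t ≠ 0) :
    ‖weilMellin (chi a 0) (1 / 2 + t * I)‖ ^ 2 ≤ 2 / (a * t ^ 2) := by
  rw [norm_sq_weilMellin_chi_zero ha ht]
  gcongr
  have := Real.sin_sq_le_one (a * t)
  linarith

/-- **Pointwise majorant**: `‖χ̂_0(½+it)‖² ≤ 2a·𝟙_{0}(t) + (2/a)·(t²)⁻¹` (`0⁻¹ = 0` at the centre). -/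
theorem norm_sq_weilMellin_chi_zero_le_majorant (ha : 0 < a) (t : ℝ) :
    ‖weilMellin (chi a 0) (1 / 2 + t * I)‖ ^ 2 ≤
      ({0} : Set ℝ).indicator (fun _ ↦ 2 * a) t + 2 / a * (t ^ 2)⁻¹ := by
  rcases eq_or_ne t 0 with rfl | ht
  · rw [indicator_of_mem (mem_singleton _), norm_sq_weilMellin_chi_zero_zero ha]
    simp
  · rw [indicator_of_notMem (by simpa using ht), zero_add]
    calc ‖weilMellin (chi a 0) (1 / 2 + t * I)‖ ^ 2 ≤ 2 / (a * t ^ 2) := norm_sq_weilMellin_chi_zero_le_div ha ht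
      _ = 2 / a * (t ^ 2)⁻¹ := by rw [div_mul_eq_div_div, div_eq_mul_inv]

/-! ## The flat-window IDENTITY: the rung's slack is the Fejér integral of the spectral measure -/

/-- **THE FLAT-WINDOW IDENTITY (measure level).**  Let `q ≠ 1`, `a > 0`, and let `μ` represent `Q_χ` on
the tests of `[-a, a]` with `(1 + t²)⁻¹ ∈ L¹(μ)`.  Then the Fejér density `‖χ̂_0(½+it)‖² = 2sin²(at)/(at²)`
is `μ`-integrable and

  `2Σ_{log n<2a} Λ(n)n^{-1/2}(1 − log n/(2a))Re χ(n) + K_κ − I_κ(a)/a = log q − ∫ ‖χ̂_0(½+it)‖² dμ(t)`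

(`K_κ = log 4π + γ + 2∫₀^∞(e^{(1/2−κ)t} − 1)dt/(2 sinh t)`, `I_κ(a) = ∫₀^∞ ρ_κ(t) min(t,2a) dt`): the
flat-window INEQUALITY of `TwistedFlatTest.lean` (`… ≤ log q`) with its slack made explicit — a
non-negative Fejér integral of the spectral measure. -/
theorem flatWindow_eq_log_sub_integral (hq : q ≠ 1) (χ : DirichletCharacter ℂ q) (ha : 0 < a)
    {μ : Measure ℝ}
    (hμ : ∀ g : ℝ → ℂ, IsWeilTest g → tsupport g ⊆ Icc (-a) a →
      Integrable (fun t : ℝ ↦ ‖weilMellin g (1 / 2 + t * I)‖ ^ 2) μ ∧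
        weilQuadraticChar χ g = ((∫ t, ‖weilMellin g (1 / 2 + t * I)‖ ^ 2 ∂μ : ℝ) : ℂ))
    (hI : Integrable (fun t : ℝ ↦ (1 + t ^ 2)⁻¹) μ) :
    Integrable (fun t : ℝ ↦ ‖weilMellin (chi a 0) (1 / 2 + t * I)‖ ^ 2) μ ∧
      2 * (∑ n ∈ weilPrimeIndex a,
            (Λ n : ℝ) / Real.sqrt n * ((1 - Real.log n / (2 * a)) * (χ (n : ZMod q)).re)) +
          (Real.log (4 * π) + Real.eulerMascheroniConstant +
            2 * ∫ t in Ioi (0 : ℝ), weilKillingDensityPar (charParity χ) t) -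
          1 / a * ∫ t in Ioi (0 : ℝ), weilArchDensityPar (charParity χ) t * min t (2 * a) =
        Real.log q - ∫ t, ‖weilMellin (chi a 0) (1 / 2 + t * I)‖ ^ 2 ∂μ := by
  obtain ⟨hint, heq⟩ := twistedWindowForm_eq_integral_of_mem_K hq χ ha hμ hI (Yoshida1992.chi_mem_K a 0)
  rw [twistedWindowForm_chi_zero χ ha] at heq
  exact ⟨hint, by linarith⟩

/-! ## Bounds for the Fejér integral: the atom at the centre and the second inverse moment -/

/-- A measure integrating `(1 + t²)⁻¹` gives finite mass to the centre. -/
theorem measure_zero_lt_top_of_integrable {μ : Measure ℝ} (hI : Integrable (fun t : ℝ ↦ (1 + t ^ 2)⁻¹) μ) :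
    μ {0} < ⊤ := by
  refine lt_of_le_of_lt (measure_mono fun t ht ↦ ?_) (hI.measure_norm_ge_lt_top zero_lt_one)
  rw [mem_singleton_iff] at ht
  subst ht
  simp

/-- **The atom at the centre is a lower bound**: `2a · μ{0} ≤ ∫ ‖χ̂_0(½+it)‖² dμ` (`‖χ̂_0(½)‖² = 2a`). -/
theorem two_mul_mul_measureReal_zero_le_integral (ha : 0 < a) {μ : Measure ℝ}
    (hint : Integrable (fun t : ℝ ↦ ‖weilMellin (chi a 0) (1 / 2 + t * I)‖ ^ 2) μ)
    (h0 : μ {0} < ⊤) :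
    2 * a * μ.real {0} ≤ ∫ t, ‖weilMellin (chi a 0) (1 / 2 + t * I)‖ ^ 2 ∂μ := by
  have hind : Integrable (fun t : ℝ ↦ ({0} : Set ℝ).indicator (fun _ ↦ 2 * a) t) μ :=
    (integrable_indicator_iff (measurableSet_singleton 0)).2 (integrableOn_const h0.ne)
  have hle : ∀ t : ℝ, ({0} : Set ℝ).indicator (fun _ ↦ 2 * a) t ≤ ‖weilMellin (chi a 0) (1 / 2 + t * I)‖ ^ 2 := by
    intro t
    by_cases ht : t ∈ ({0} : Set ℝ)
    · rw [indicator_of_mem ht, mem_singleton_iff.1 ht, norm_sq_weilMellin_chi_zero_zero ha]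
    · rw [indicator_of_notMem ht]; positivity
  calc 2 * a * μ.real {0} = ∫ t, ({0} : Set ℝ).indicator (fun _ ↦ 2 * a) t ∂μ := by
        rw [integral_indicator_const _ (measurableSet_singleton 0), smul_eq_mul, mul_comm]
    _ ≤ _ := integral_mono hind hint hle

/-- **The Fejér integral is at most the atom plus `(2/a)·∫ t⁻² dμ`**:
`∫ ‖χ̂_0(½+it)‖² dμ ≤ 2a · μ{0} + (2/a) ∫ t⁻² dμ(t)` (Lean's `0⁻¹ = 0`: the moment ignores the centre). -/
theorem integral_norm_sq_weilMellin_chi_zero_le (ha : 0 < a) {μ : Measure ℝ}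
    (hint : Integrable (fun t : ℝ ↦ ‖weilMellin (chi a 0) (1 / 2 + t * I)‖ ^ 2) μ)
    (h0 : μ {0} < ⊤) (hM : Integrable (fun t : ℝ ↦ (t ^ 2)⁻¹) μ) :
    ∫ t, ‖weilMellin (chi a 0) (1 / 2 + t * I)‖ ^ 2 ∂μ ≤ 2 * a * μ.real {0} + 2 / a * ∫ t, (t ^ 2)⁻¹ ∂μ := by
  have hind : Integrable (fun t : ℝ ↦ ({0} : Set ℝ).indicator (fun _ ↦ 2 * a) t) μ :=
    (integrable_indicator_iff (measurableSet_singleton 0)).2 (integrableOn_const h0.ne)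
  calc ∫ t, ‖weilMellin (chi a 0) (1 / 2 + t * I)‖ ^ 2 ∂μ
      ≤ ∫ t, ({0} : Set ℝ).indicator (fun _ ↦ 2 * a) t + 2 / a * (t ^ 2)⁻¹ ∂μ :=
        integral_mono hint (hind.add (hM.const_mul _)) (norm_sq_weilMellin_chi_zero_le_majorant ha)
    _ = 2 * a * μ.real {0} + 2 / a * ∫ t, (t ^ 2)⁻¹ ∂μ := by
        rw [integral_add hind (hM.const_mul _), integral_indicator_const _ (measurableSet_singleton 0),
          integral_const_mul, smul_eq_mul, mul_comm (μ.real {0})]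

/-! ## THE SANDWICH: the flat-window inequality is sharp up to `O(1/a)`, and the atom is the slope -/

/-- **THE FLAT-WINDOW SANDWICH (measure level, RH/GRH-free).**  Let `q ≠ 1`, `a > 0`, and let `μ`
represent `Q_χ` on the tests of `[-a, a]`, with `(1 + t²)⁻¹, t⁻² ∈ L¹(μ)`; write `m₀ = μ{0}`,
`M₂ = ∫ t⁻² dμ`, `S_χ(a) = Σ_{log n<2a} Λ(n)n^{-1/2}(1 − log n/(2a))Re χ(n)`.  Then

  `log q − K_κ + I_κ(a)/a − 2a·m₀ − (2/a)M₂ ≤ 2S_χ(a) ≤ log q − K_κ + I_κ(a)/a − 2a·m₀`.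

The right inequality SHARPENS the rung inequality of `TwistedFlatTest.lean` by the atom (a spectral mass
at the centre lowers the ceiling linearly in `a`); the left one says the rung inequality is otherwise
SHARP to `O(1/a)`. -/
theorem flatWindow_sandwich (hq : q ≠ 1) (χ : DirichletCharacter ℂ q) (ha : 0 < a) {μ : Measure ℝ}
    (hμ : ∀ g : ℝ → ℂ, IsWeilTest g → tsupport g ⊆ Icc (-a) a →
      Integrable (fun t : ℝ ↦ ‖weilMellin g (1 / 2 + t * I)‖ ^ 2) μ ∧
        weilQuadraticChar χ g = ((∫ t, ‖weilMellin g (1 / 2 + t * I)‖ ^ 2 ∂μ : ℝ) : ℂ))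
    (hI : Integrable (fun t : ℝ ↦ (1 + t ^ 2)⁻¹) μ) (hM : Integrable (fun t : ℝ ↦ (t ^ 2)⁻¹) μ) :
    Real.log q -
          (Real.log (4 * π) + Real.eulerMascheroniConstant +
            2 * ∫ t in Ioi (0 : ℝ), weilKillingDensityPar (charParity χ) t) +
          1 / a * (∫ t in Ioi (0 : ℝ), weilArchDensityPar (charParity χ) t * min t (2 * a)) -
          2 * a * μ.real {0} - 2 / a * ∫ t, (t ^ 2)⁻¹ ∂μ ≤
        2 * (∑ n ∈ weilPrimeIndex a,
          (Λ n : ℝ) / Real.sqrt n * ((1 - Real.log n / (2 * a)) * (χ (n : ZMod q)).re)) ∧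
      2 * (∑ n ∈ weilPrimeIndex a,
          (Λ n : ℝ) / Real.sqrt n * ((1 - Real.log n / (2 * a)) * (χ (n : ZMod q)).re)) ≤
        Real.log q -
          (Real.log (4 * π) + Real.eulerMascheroniConstant +
            2 * ∫ t in Ioi (0 : ℝ), weilKillingDensityPar (charParity χ) t) +
          1 / a * (∫ t in Ioi (0 : ℝ), weilArchDensityPar (charParity χ) t * min t (2 * a)) -
          2 * a * μ.real {0} := by
  obtain ⟨hint, heq⟩ := flatWindow_eq_log_sub_integral hq χ ha hμ hI
  have h0 := measure_zero_lt_top_of_integrable hI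
  have hlo := two_mul_mul_measureReal_zero_le_integral ha hint h0
  have hhi := integral_norm_sq_weilMellin_chi_zero_le ha hint h0 hM
  constructor <;> linarith

/-- **THE RUNG INEQUALITY SHARPENED BY THE ATOM**: `2S_χ(a) + K_κ − I_κ(a)/a + 2a·μ{0} ≤ log q` —
spectral mass AT the centre (under `GRH(χ)`: the multiplicity of the central zero `L(½, χ) = 0`) lowers
the flat-window ceiling of `TwistedFlatTest.lean` linearly in the window. -/
theorem flatWindow_add_atom_le_log (hq : q ≠ 1) (χ : DirichletCharacter ℂ q) (ha : 0 < a) {μ : Measure ℝ}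
    (hμ : ∀ g : ℝ → ℂ, IsWeilTest g → tsupport g ⊆ Icc (-a) a →
      Integrable (fun t : ℝ ↦ ‖weilMellin g (1 / 2 + t * I)‖ ^ 2) μ ∧
        weilQuadraticChar χ g = ((∫ t, ‖weilMellin g (1 / 2 + t * I)‖ ^ 2 ∂μ : ℝ) : ℂ))
    (hI : Integrable (fun t : ℝ ↦ (1 + t ^ 2)⁻¹) μ) :
    2 * (∑ n ∈ weilPrimeIndex a,
          (Λ n : ℝ) / Real.sqrt n * ((1 - Real.log n / (2 * a)) * (χ (n : ZMod q)).re)) +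
        (Real.log (4 * π) + Real.eulerMascheroniConstant +
          2 * ∫ t in Ioi (0 : ℝ), weilKillingDensityPar (charParity χ) t) -
        1 / a * (∫ t in Ioi (0 : ℝ), weilArchDensityPar (charParity χ) t * min t (2 * a)) +
        2 * a * μ.real {0} ≤ Real.log q := by
  obtain ⟨hint, heq⟩ := flatWindow_eq_log_sub_integral hq χ ha hμ hI
  have hlo := two_mul_mul_measureReal_zero_le_integral ha hint (measure_zero_lt_top_of_integrable hI)
  linarith

/-- **THE FLAT WINDOW IS ASYMPTOTICALLY EXTREMAL: `|2S_χ(a) + 2a·μ{0} − (log q − K_κ)| ≤ (5 + 2M₂)/a`.**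
(`0 ≤ I_κ(a) ≤ 5`, `TwistedFlatTestBounds`.)  The smoothed twisted prime sum below the horizon `e^{2a}`
is, up to `O(1/a)`, the AFFINE function `−μ{0}·2a + (log q − K_κ)` of the window: the atom at the
centre is the SLOPE and `log q − K_κ` (`= −2Re(L′/L)(½, χ)` for primitive `χ` with `L(½, χ) ≠ 0`,
`FlatTestCentralL.neg_two_mul_re_logDeriv_LFunction_one_half`) is the INTERCEPT. -/
theorem abs_flatSum_add_atom_sub_le (hq : q ≠ 1) (χ : DirichletCharacter ℂ q) (ha : 0 < a)
    {μ : Measure ℝ}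
    (hμ : ∀ g : ℝ → ℂ, IsWeilTest g → tsupport g ⊆ Icc (-a) a →
      Integrable (fun t : ℝ ↦ ‖weilMellin g (1 / 2 + t * I)‖ ^ 2) μ ∧
        weilQuadraticChar χ g = ((∫ t, ‖weilMellin g (1 / 2 + t * I)‖ ^ 2 ∂μ : ℝ) : ℂ))
    (hI : Integrable (fun t : ℝ ↦ (1 + t ^ 2)⁻¹) μ) (hM : Integrable (fun t : ℝ ↦ (t ^ 2)⁻¹) μ) :
    |2 * (∑ n ∈ weilPrimeIndex a,
          (Λ n : ℝ) / Real.sqrt n * ((1 - Real.log n / (2 * a)) * (χ (n : ZMod q)).re)) +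
        2 * a * μ.real {0} -
        (Real.log q - (Real.log (4 * π) + Real.eulerMascheroniConstant +
            2 * ∫ t in Ioi (0 : ℝ), weilKillingDensityPar (charParity χ) t))| ≤
      (5 + 2 * ∫ t, (t ^ 2)⁻¹ ∂μ) / a := by
  obtain ⟨hlo, hhi⟩ := flatWindow_sandwich hq χ ha hμ hI hM
  have hI5 := integral_weilArchDensityPar_mul_min_le_five (charParity χ) ha.le
  have hI0 := integral_weilArchDensityPar_mul_min_nonneg (charParity χ) ha.le
  have hM0 : 0 ≤ ∫ t, (t ^ 2)⁻¹ ∂μ := integral_nonneg fun t ↦ by positivity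
  set Iκ := ∫ t in Ioi (0 : ℝ), weilArchDensityPar (charParity χ) t * min t (2 * a) with hIκ
  set M₂ := ∫ t, (t ^ 2)⁻¹ ∂μ with hM₂
  have e1 : 1 / a * Iκ ≤ 5 / a := by
    rw [one_div_mul_eq_div]; exact div_le_div_of_nonneg_right hI5 ha.le
  have e2 : 0 ≤ 1 / a * Iκ := by positivity
  have e3 : (5 + 2 * M₂) / a = 5 / a + 2 / a * M₂ := by field_simp
  rw [abs_le, e3]
  constructor <;> linarith

/-! ## All windows: the asymptotics `a → ∞` -/

/-- **ASYMPTOTIC EXTREMALITY OF THE FLAT WINDOW.**  Let `q ≠ 1` and let `μ` represent `Q_χ` on ALL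
tests (every window; under `GRH(χ)` the zero heights of `L(s, χ)`), with `(1 + t²)⁻¹, t⁻² ∈ L¹(μ)`.  Then

  `2S_χ(a) + 2a·μ{0} → log q − K_κ`  (`a → ∞`):

the family of flat-window inequalities `2S_χ(a) + K_κ − I_κ(a)/a ≤ log q` (one per window) is an
asymptotic EQUALITY exactly when the spectral measure has no atom at the centre. -/
theorem tendsto_flatSum_add_atom (hq : q ≠ 1) (χ : DirichletCharacter ℂ q) {μ : Measure ℝ}
    (hμ : ∀ g : ℝ → ℂ, IsWeilTest g →
      Integrable (fun t : ℝ ↦ ‖weilMellin g (1 / 2 + t * I)‖ ^ 2) μ ∧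
        weilQuadraticChar χ g = ((∫ t, ‖weilMellin g (1 / 2 + t * I)‖ ^ 2 ∂μ : ℝ) : ℂ))
    (hI : Integrable (fun t : ℝ ↦ (1 + t ^ 2)⁻¹) μ) (hM : Integrable (fun t : ℝ ↦ (t ^ 2)⁻¹) μ) :
    Tendsto (fun a : ℝ ↦ 2 * (∑ n ∈ weilPrimeIndex a,
          (Λ n : ℝ) / Real.sqrt n * ((1 - Real.log n / (2 * a)) * (χ (n : ZMod q)).re)) +
        2 * a * μ.real {0}) atTop
      (𝓝 (Real.log q - (Real.log (4 * π) + Real.eulerMascheroniConstant +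
            2 * ∫ t in Ioi (0 : ℝ), weilKillingDensityPar (charParity χ) t))) := by
  set L := Real.log q - (Real.log (4 * π) + Real.eulerMascheroniConstant +
    2 * ∫ t in Ioi (0 : ℝ), weilKillingDensityPar (charParity χ) t) with hL
  set C := 5 + 2 * ∫ t, (t ^ 2)⁻¹ ∂μ with hC
  set f := fun a : ℝ ↦ 2 * (∑ n ∈ weilPrimeIndex a,
          (Λ n : ℝ) / Real.sqrt n * ((1 - Real.log n / (2 * a)) * (χ (n : ZMod q)).re)) +
        2 * a * μ.real {0} with hf
  have hb : ∀ a : ℝ, 0 < a → |f a - L| ≤ C / a := fun a ha ↦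
    abs_flatSum_add_atom_sub_le hq χ ha (fun g hg _ ↦ hμ g hg) hI hM
  have hC : Tendsto (fun a : ℝ ↦ C / a) atTop (𝓝 0) := tendsto_const_nhds.div_atTop tendsto_id
  have h0 : Tendsto (fun a : ℝ ↦ f a - L) atTop (𝓝 0) := by
    refine squeeze_zero_norm' ?_ hC
    filter_upwards [eventually_gt_atTop (0 : ℝ)] with a ha
    rw [Real.norm_eq_abs]
    exact hb a ha
  have := h0.add_const L
  simpa using this

/-- **THE ATOM IS THE SLOPE**: `S_χ(a)/a → −μ{0}` (`a → ∞`).  Under `GRH(χ)` the atom is the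
multiplicity of the central zero: the smoothed twisted prime sum below the horizon decreases linearly at
rate the order of vanishing of `L(s, χ)` at `s = ½` (cf. the Goldfeld / explicit-formula route to the
analytic rank), and is bounded iff `L(½, χ) ≠ 0`. -/
theorem tendsto_flatSum_div (hq : q ≠ 1) (χ : DirichletCharacter ℂ q) {μ : Measure ℝ}
    (hμ : ∀ g : ℝ → ℂ, IsWeilTest g →
      Integrable (fun t : ℝ ↦ ‖weilMellin g (1 / 2 + t * I)‖ ^ 2) μ ∧
        weilQuadraticChar χ g = ((∫ t, ‖weilMellin g (1 / 2 + t * I)‖ ^ 2 ∂μ : ℝ) : ℂ))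
    (hI : Integrable (fun t : ℝ ↦ (1 + t ^ 2)⁻¹) μ) (hM : Integrable (fun t : ℝ ↦ (t ^ 2)⁻¹) μ) :
    Tendsto (fun a : ℝ ↦ (∑ n ∈ weilPrimeIndex a,
          (Λ n : ℝ) / Real.sqrt n * ((1 - Real.log n / (2 * a)) * (χ (n : ZMod q)).re)) / a) atTop
      (𝓝 (-μ.real {0})) := by
  have h := tendsto_flatSum_add_atom hq χ hμ hI hM
  set L := Real.log q - (Real.log (4 * π) + Real.eulerMascheroniConstant +
    2 * ∫ t in Ioi (0 : ℝ), weilKillingDensityPar (charParity χ) t) with hL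
  set S := fun a : ℝ ↦ ∑ n ∈ weilPrimeIndex a,
          (Λ n : ℝ) / Real.sqrt n * ((1 - Real.log n / (2 * a)) * (χ (n : ZMod q)).re) with hS
  -- `(2S(a) + 2a m₀)/(2a) → 0`
  have h1 : Tendsto (fun a : ℝ ↦ (2 * S a + 2 * a * μ.real {0}) / (2 * a)) atTop (𝓝 0) := by
    have h2a : Tendsto (fun a : ℝ ↦ 2 * a) atTop atTop := tendsto_id.const_mul_atTop two_pos
    exact h.div_atTop h2a
  have h2 : Tendsto (fun a : ℝ ↦ (2 * S a + 2 * a * μ.real {0}) / (2 * a) - μ.real {0}) atTop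
      (𝓝 (0 - μ.real {0})) := h1.sub_const _
  rw [zero_sub] at h2
  refine h2.congr' ?_
  filter_upwards [eventually_gt_atTop (0 : ℝ)] with a ha
  show (2 * S a + 2 * a * μ.real {0}) / (2 * a) - μ.real {0} = S a / a
  field_simp
  ring

/-- **No atom at the centre ⟹ the flat window is asymptotically extremal**:
`2S_χ(a) → log q − K_κ` (`a → ∞`). -/
theorem tendsto_flatSum_of_measure_zero (hq : q ≠ 1) (χ : DirichletCharacter ℂ q) {μ : Measure ℝ}
    (hμ : ∀ g : ℝ → ℂ, IsWeilTest g →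
      Integrable (fun t : ℝ ↦ ‖weilMellin g (1 / 2 + t * I)‖ ^ 2) μ ∧
        weilQuadraticChar χ g = ((∫ t, ‖weilMellin g (1 / 2 + t * I)‖ ^ 2 ∂μ : ℝ) : ℂ))
    (hI : Integrable (fun t : ℝ ↦ (1 + t ^ 2)⁻¹) μ) (hM : Integrable (fun t : ℝ ↦ (t ^ 2)⁻¹) μ)
    (h0 : μ {0} = 0) :
    Tendsto (fun a : ℝ ↦ 2 * (∑ n ∈ weilPrimeIndex a,
          (Λ n : ℝ) / Real.sqrt n * ((1 - Real.log n / (2 * a)) * (χ (n : ZMod q)).re))) atTop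
      (𝓝 (Real.log q - (Real.log (4 * π) + Real.eulerMascheroniConstant +
            2 * ∫ t in Ioi (0 : ℝ), weilKillingDensityPar (charParity χ) t))) := by
  have h := tendsto_flatSum_add_atom hq χ hμ hI hM
  have hm : μ.real {0} = 0 := by rw [measureReal_def, h0, ENNReal.toReal_zero]
  simpa [hm] using h


end Summit.Ventures.WeilGRH

end
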